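import Literature.MathematicalPhysics.QuantumFieldTheory.QuasiLocalGaugePerturbationCells
import Literature.Probability.LatticeModels.GibbsSpecificationTiltedHetero
import Mathlib.MeasureTheory.Integral.Pi
import HarnessLib

/-!
# Quasi-local gauge-invariant perturbations, VII: the Bernoulli decoupling of the far polymers

Seventh file on the tree's `QuasiLocalGaugePerturbation d N G b`. A perturbation `W = ∑_X W_X`
with small Kotecký–Preiss norm splits into NEAR activities (single blocks, `|X| = 1`) and FAR
activities (`|X| ≥ 2`). Each far Boltzmann factor is an exact mixture of "no interaction" and a
bounded POSITIVE tilt: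

`e^{-W_X(U)} = e^{-s_X} ((1 - p_X) + p_X h_X(U))`, `s_X = ‖W_X‖_∞`, `p_X = 1 - e^{-2 s_X}`,
`h_X = 1 + (e^{s_X - W_X} - 1)/p_X ∈ [1, 1 + e^{2 s_X}]`

(`decoupling_identity`). Hence the perturbed torus measure `μ_{β,W}` is the `U`-marginal of a
JOINT Gibbs measure of the link variables `U` and independent Bernoulli MARKS `n_X ∈ {0,1}`, one per
far polymer, with energy `-β S_W(U) - W_near(U) + ∑_X n_X log h_X(U)` relative to the product of
Haar measures and Bernoulli(`p_X`) laws (a random-cluster / Edwards–Sokal type representation; an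
INACTIVE mark `n_X = 0` removes the polymer `X` from the interaction exactly). This file builds the
joint system as a Gibbsian specification with site-dependent a priori measures on the site set
`JSite := Edge d N ⊕ FarPoly` with spin space `G × Bool` (`GibbsSpecificationTiltedHetero.lean`):

* `restrict`, `farPolymers` / `FarPoly`, `pAct`, `hTilt`, `rAct`, `decoupling_identity`, `bern`;
* `uOf`, `markOf`, `marksEmb`, `jointRef`, `siteTerm`, `jointEnergy`, `jointSpec`, `jointMeasure`;
* `isSpecification_jointSpec`, `jointSpec_univ`, `isGibbsMeasure_jointMeasure` — the DLR structure
  of the joint system.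

The companion theorem files prove the kernel-uniform rarity of active marks (F2,
`…DecouplingMarks`), the identification of the `U`-marginals of the joint kernels with the
dressed kernels of the link field (F1, `…DecouplingMarginal`) and the hyper-Markov property of the
joint kernels (`…DecouplingMarkov`) — the inputs of the two-species (hyperedge-defect)
Dobrushin–Shlosman engine for dressed gauge measures.

## References

* R. G. Edwards, A. D. Sokal, Phys. Rev. D 38 (1988) 2009 (joint spin/bond representations);
  H.-O. Georgii, O. Häggström, C. Maes, *The random geometry of equilibrium phases* (2001), §6.
* H.-O. Georgii, *Gibbs Measures and Phase Transitions* (2011), Def. 1.23, Def. 2.9, Ch. 8.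
* T. Bałaban, CMP 119 (1988) 243–285, p. 259–261 (format of `W`).
-/

noncomputable section

open MeasureTheory Finset
open scoped ENNReal
open Literature.Probability.LatticeModels (glueWith glueWith_apply_mem glueWith_apply_not_mem
  measurable_glueWith Specification IsSpecification IsGibbsMeasure
  isSpecification_tilted_map_glueWith_pi_hetero map_glueWith_univ_pi_hetero
  integral_glued_tilted_le_exp_mul_hetero integral_glued_tilted_eq_hetero integrable_exp_of_abs_le
  integral_tilted_map_eq_integral_tilted_comp)
open Literature.MathematicalPhysics.QuantumLattice

namespace Literature.MathematicalPhysics.QuantumFieldTheory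

namespace QuasiLocalGaugePerturbation

variable {d N : ℕ} [NeZero N] {G : Type*} [Group G] [MeasurableSpace G] {b : ℕ}

/-! ### Restriction of a perturbation to a class of polymers; near and far polymers -/

/-- The perturbation keeping only the activities of the polymers satisfying `P`. [folklore] -/
def restrict (W : QuasiLocalGaugePerturbation d N G b) (P : Finset (Site d N) → Prop)
    [DecidablePred P] : QuasiLocalGaugePerturbation d N G b where
  act X U := if P X then W.act X U else 0
  dependsOn' X := fun U U' h => by
    by_cases hP : P X
    · simp only [hP, if_true]; exact W.dependsOn X h
    · simp only [hP, if_false]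
  gaugeInvariant' X := fun g U => by
    by_cases hP : P X
    · simp only [hP, if_true]; exact W.isGaugeInvariant_act X g U
    · simp only [hP, if_false]
  measurable' X := by
    by_cases hP : P X
    · simp only [hP, if_true]; exact W.measurable_act X
    · simp only [hP, if_false]; exact measurable_const
  bounded' X := by
    obtain ⟨C, hC⟩ := W.bounded' X
    refine ⟨C, fun U => ?_⟩
    by_cases hP : P X
    · simp only [hP, if_true]; exact hC U
    · simp only [hP, if_false, abs_zero]; exact (abs_nonneg _).trans (hC U)

/-- Activities of a restriction. [folklore] -/
@[simp] theorem restrict_act (W : QuasiLocalGaugePerturbation d N G b) (P : Finset (Site d N) → Prop)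
    [DecidablePred P] (X : Finset (Site d N)) (U : GaugeConfig d N G) :
    (W.restrict P).act X U = if P X then W.act X U else 0 := rfl

/-- Sup norms of a restriction are those of `W` on `P` and `0` off `P`. [folklore] -/
theorem supNorm_restrict (W : QuasiLocalGaugePerturbation d N G b) (P : Finset (Site d N) → Prop)
    [DecidablePred P] (X : Finset (Site d N)) :
    (W.restrict P).supNorm X = if P X then W.supNorm X else 0 := by
  by_cases hP : P X
  · simp [supNorm, hP]
  · simp [supNorm, hP]

/-- Sup norms of a restriction are at most those of `W`. [folklore] -/
theorem supNorm_restrict_le (W : QuasiLocalGaugePerturbation d N G b) (P : Finset (Site d N) → Prop)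
    [DecidablePred P] (X : Finset (Site d N)) : (W.restrict P).supNorm X ≤ W.supNorm X := by
  rw [supNorm_restrict]
  split_ifs
  · exact le_rfl
  · exact W.supNorm_nonneg X

/-- Restriction does not increase the weighted norm. [folklore] -/
theorem NormLE.restrict {W : QuasiLocalGaugePerturbation d N G b} {κ η : ℝ} (h : W.NormLE κ η)
    (P : Finset (Site d N) → Prop) [DecidablePred P] : (W.restrict P).NormLE κ η := fun y hy =>
  (sum_le_sum fun X _ => mul_le_mul_of_nonneg_right (W.supNorm_restrict_le P X)
    (Real.exp_pos _).le).trans (h y hy)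

/-- The total of a restriction is the sum of the activities over the polymers with `P`.
[folklore] -/
theorem total_restrict (W : QuasiLocalGaugePerturbation d N G b) (P : Finset (Site d N) → Prop)
    [DecidablePred P] (U : GaugeConfig d N G) :
    (W.restrict P).total U = ∑ X ∈ (polymers b).filter P, W.act X U := by
  simp [total, Finset.sum_filter]

variable (b) in
/-- **Far polymers**: the polymers with at least two blocks. [folklore] -/
def farPolymers : Finset (Finset (Site d N)) := (polymers b).filter fun X => 2 ≤ X.card

/-- Membership in `farPolymers`. [folklore] -/
theorem mem_farPolymers_iff {X : Finset (Site d N)} :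
    X ∈ farPolymers (d := d) (N := N) b ↔ X ∈ polymers b ∧ 2 ≤ X.card := mem_filter

/-! ### The decoupling of one far Boltzmann factor -/

/-- The decoupling probability `p_X = 1 - e^{-2 s_X}` (`s_X = ‖W_X‖_∞`). [folklore] -/
def pAct (W : QuasiLocalGaugePerturbation d N G b) (X : Finset (Site d N)) : ℝ :=
  1 - Real.exp (-2 * W.supNorm X)

/-- The positive bounded tilt `h_X(U) = 1 + (e^{s_X - W_X(U)} - 1)/p_X` (junk-free: for
`s_X = 0` the quotient is `0/0 = 0` and `h_X = 1`). [folklore] -/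
def hTilt (W : QuasiLocalGaugePerturbation d N G b) (X : Finset (Site d N)) (U : GaugeConfig d N G) :
    ℝ := 1 + (Real.exp (W.supNorm X - W.act X U) - 1) / W.pAct X

/-- The rarity level of an active mark, `r_X = p_X (1 + e^{2 s_X})`. [folklore] -/
def rAct (W : QuasiLocalGaugePerturbation d N G b) (X : Finset (Site d N)) : ℝ :=
  W.pAct X * (1 + Real.exp (2 * W.supNorm X))

variable (W : QuasiLocalGaugePerturbation d N G b)

/-- `0 ≤ p_X`. [folklore] -/
theorem pAct_nonneg (X : Finset (Site d N)) : 0 ≤ W.pAct X := by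
  have : Real.exp (-2 * W.supNorm X) ≤ 1 :=
    Real.exp_le_one_iff.2 (by nlinarith [W.supNorm_nonneg X])
  unfold pAct; linarith

/-- `p_X < 1`. [folklore] -/
theorem pAct_lt_one (X : Finset (Site d N)) : W.pAct X < 1 := by
  unfold pAct; linarith [Real.exp_pos (-2 * W.supNorm X)]

/-- `p_X ≤ 1`. [folklore] -/
theorem pAct_le_one (X : Finset (Site d N)) : W.pAct X ≤ 1 := (W.pAct_lt_one X).le

/-- `p_X ≤ 2 s_X` (`1 - e^{-x} ≤ x`). [folklore] -/
theorem pAct_le_two_mul_supNorm (X : Finset (Site d N)) : W.pAct X ≤ 2 * W.supNorm X := by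
  unfold pAct
  have := Real.add_one_le_exp (-2 * W.supNorm X)
  linarith

/-- `p_X = 0` iff `s_X = 0`. [folklore] -/
theorem pAct_eq_zero_iff (X : Finset (Site d N)) : W.pAct X = 0 ↔ W.supNorm X = 0 := by
  unfold pAct
  constructor
  · intro h
    have h1 : Real.exp (-2 * W.supNorm X) = 1 := by linarith
    rw [Real.exp_eq_one_iff] at h1
    linarith
  · intro h
    rw [h, mul_zero, Real.exp_zero, sub_self]

/-- `0 ≤ r_X`. [folklore] -/
theorem rAct_nonneg (X : Finset (Site d N)) : 0 ≤ W.rAct X :=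
  mul_nonneg (W.pAct_nonneg X) (by positivity)

/-- `r_X ≤ 2 s_X (1 + e^{2 s_X})`. [folklore] -/
theorem rAct_le (X : Finset (Site d N)) :
    W.rAct X ≤ 2 * W.supNorm X * (1 + Real.exp (2 * W.supNorm X)) :=
  mul_le_mul_of_nonneg_right (W.pAct_le_two_mul_supNorm X) (by positivity)

/-- `e^{s_X - W_X(U)} ∈ [1, e^{2 s_X}]`. [folklore] -/
theorem one_le_exp_supNorm_sub_act (X : Finset (Site d N)) (U : GaugeConfig d N G) :
    1 ≤ Real.exp (W.supNorm X - W.act X U) ∧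
      Real.exp (W.supNorm X - W.act X U) ≤ Real.exp (2 * W.supNorm X) := by
  have h := abs_le.1 (W.abs_act_le_supNorm X U)
  constructor
  · exact Real.one_le_exp (by linarith [h.2])
  · exact Real.exp_le_exp.2 (by linarith [h.1])

/-- `1 ≤ h_X(U)`. [folklore] -/
theorem one_le_hTilt (X : Finset (Site d N)) (U : GaugeConfig d N G) : 1 ≤ W.hTilt X U := by
  unfold hTilt
  have h1 := (W.one_le_exp_supNorm_sub_act X U).1
  have : 0 ≤ (Real.exp (W.supNorm X - W.act X U) - 1) / W.pAct X :=
    div_nonneg (by linarith) (W.pAct_nonneg X)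
  linarith

/-- `0 < h_X(U)`. [folklore] -/
theorem hTilt_pos (X : Finset (Site d N)) (U : GaugeConfig d N G) : 0 < W.hTilt X U :=
  zero_lt_one.trans_le (W.one_le_hTilt X U)

/-- `h_X(U) ≤ 1 + e^{2 s_X}`. [folklore] -/
theorem hTilt_le (X : Finset (Site d N)) (U : GaugeConfig d N G) :
    W.hTilt X U ≤ 1 + Real.exp (2 * W.supNorm X) := by
  unfold hTilt
  rcases (W.pAct_nonneg X).eq_or_lt with h0 | hpos
  · rw [← h0, div_zero]; linarith [Real.exp_pos (2 * W.supNorm X)]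
  · -- `(e^{s-W} - 1)/p ≤ (e^{2s} - 1)/(1 - e^{-2s}) = e^{2s}`
    have h2 := (W.one_le_exp_supNorm_sub_act X U).2
    have hp : W.pAct X = 1 - Real.exp (-2 * W.supNorm X) := rfl
    have hkey : Real.exp (2 * W.supNorm X) - 1 = Real.exp (2 * W.supNorm X) * W.pAct X := by
      rw [hp, mul_sub, mul_one, ← Real.exp_add,
        show 2 * W.supNorm X + -2 * W.supNorm X = 0 by ring, Real.exp_zero]
    have : (Real.exp (W.supNorm X - W.act X U) - 1) / W.pAct X ≤ Real.exp (2 * W.supNorm X) := by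
      rw [div_le_iff₀ hpos]; linarith
    linarith

/-- **The decoupling identity**: `(1 - p_X) + p_X h_X(U) = e^{s_X - W_X(U)}`. [folklore] -/
theorem decoupling_identity (X : Finset (Site d N)) (U : GaugeConfig d N G) :
    (1 - W.pAct X) + W.pAct X * W.hTilt X U = Real.exp (W.supNorm X - W.act X U) := by
  unfold hTilt
  rcases (W.pAct_nonneg X).eq_or_lt with h0 | hpos
  · -- `s_X = 0`, so `W_X ≡ 0`
    have hs : W.supNorm X = 0 := (W.pAct_eq_zero_iff X).1 h0.symm
    have hact : W.act X U = 0 := by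
      have := W.abs_act_le_supNorm X U
      rw [hs] at this
      exact abs_nonpos_iff.1 this
    rw [← h0, hs, hact]; simp
  · field_simp
    ring

/-- `log h_X ∈ [0, log (1 + e^{2 s_X})]`, hence `|log h_X| ≤ 1 + 2 s_X`. [folklore] -/
theorem abs_log_hTilt_le (X : Finset (Site d N)) (U : GaugeConfig d N G) :
    |Real.log (W.hTilt X U)| ≤ 1 + 2 * W.supNorm X := by
  have h1 := W.one_le_hTilt X U
  have h2 := W.hTilt_le X U
  have hlog0 : 0 ≤ Real.log (W.hTilt X U) := Real.log_nonneg h1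
  rw [abs_of_nonneg hlog0]
  have h3 : Real.log (W.hTilt X U) ≤ Real.log (1 + Real.exp (2 * W.supNorm X)) :=
    Real.log_le_log (W.hTilt_pos X U) h2
  have h4 : Real.log (1 + Real.exp (2 * W.supNorm X)) ≤ 1 + 2 * W.supNorm X := by
    have hpos : 0 < 1 + Real.exp (2 * W.supNorm X) := by positivity
    rw [Real.log_le_iff_le_exp hpos, Real.exp_add]
    have he := Real.add_one_le_exp (1 : ℝ)
    have h1' : 1 ≤ Real.exp (2 * W.supNorm X) :=
      Real.one_le_exp (by nlinarith [W.supNorm_nonneg X])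
    nlinarith
  linarith

/-- `h_X` is measurable in `U`. [folklore] -/
@[fun_prop] theorem measurable_hTilt (X : Finset (Site d N)) : Measurable (W.hTilt X) := by
  unfold hTilt; fun_prop

/-! ### The Bernoulli reference law of a mark -/

/-- The Bernoulli law on `Bool` with `P(true) = p` (for `p ∈ [0,1]`). [folklore] -/
def bern (p : ℝ) : Measure Bool :=
  ENNReal.ofReal (1 - p) • Measure.dirac false + ENNReal.ofReal p • Measure.dirac true

/-- `bern p` is a probability measure for `p ∈ [0,1]`. [folklore] -/
theorem isProbabilityMeasure_bern {p : ℝ} (h0 : 0 ≤ p) (h1 : p ≤ 1) :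
    IsProbabilityMeasure (bern p) := by
  refine ⟨?_⟩
  simp only [bern, Measure.coe_add, Measure.coe_smul, Pi.add_apply, Pi.smul_apply,
    measure_univ, smul_eq_mul, mul_one]
  rw [← ENNReal.ofReal_add (by linarith) h0]
  simp

/-- Integral against `bern p`. [folklore] -/
theorem integral_bern {p : ℝ} (h0 : 0 ≤ p) (h1 : p ≤ 1) (f : Bool → ℝ) :
    ∫ n, f n ∂(bern p) = (1 - p) * f false + p * f true := by
  simp only [bern]
  rw [integral_add_measure, integral_smul_measure, integral_smul_measure, integral_dirac,
    integral_dirac, ENNReal.toReal_ofReal (by linarith), ENNReal.toReal_ofReal h0]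
  · simp [smul_eq_mul]
  · exact (integrable_dirac (by simp)).smul_measure ENNReal.ofReal_ne_top
  · exact (integrable_dirac (by simp)).smul_measure ENNReal.ofReal_ne_top

/-! ### The joint system: sites, spins, reference measures, energy, kernels -/

variable (b) in
/-- The type of far polymers at block scale `b` (the index set of the marks). [folklore] -/
abbrev FarPoly (d N : ℕ) [NeZero N] : Type := ↥(farPolymers (d := d) (N := N) b)

variable (b) in
/-- The sites of the joint system: links and far polymers. [folklore] -/
abbrev JSite (d N : ℕ) [NeZero N] : Type := Edge d N ⊕ FarPoly b d N

/-- The link field of a joint configuration (first components at the link sites). [folklore] -/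
def uOf (ξ : JSite b d N → G × Bool) : GaugeConfig d N G := fun e => (ξ (Sum.inl e)).1

/-- The mark of the far polymer `X` in a joint configuration. [folklore] -/
def markOf (ξ : JSite b d N → G × Bool) (X : FarPoly b d N) : Bool := (ξ (Sum.inr X)).2

omit [Group G] in
/-- `uOf` is measurable. [folklore] -/
@[fun_prop] theorem measurable_uOf : Measurable (uOf (b := b) (d := d) (N := N) (G := G)) :=
  measurable_pi_lambda _ fun _ => measurable_fst.comp (measurable_pi_apply _)

omit [Group G] in
/-- `markOf · X` is measurable. [folklore] -/
@[fun_prop] theorem measurable_markOf (X : FarPoly b d N) :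
    Measurable fun ξ : JSite b d N → G × Bool => markOf ξ X :=
  measurable_snd.comp (measurable_pi_apply _)

variable (b) in
/-- The embedding of the far polymers as mark sites. [folklore] -/
def marksEmb (d N : ℕ) [NeZero N] : FarPoly b d N ↪ JSite b d N := ⟨Sum.inr, Sum.inr_injective⟩

omit [Group G] [MeasurableSpace G] in
/-- `marksEmb X = inr X`. [folklore] -/
@[simp] theorem marksEmb_apply (X : FarPoly b d N) : marksEmb b d N X = Sum.inr X := rfl

omit [Group G] in
/-- Measurability of the all-active event of a set of marks. [folklore] -/
theorem measurableSet_allActive (M : Finset (FarPoly b d N)) :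
    MeasurableSet {σ : JSite b d N → G × Bool | ∀ X ∈ M, markOf σ X = true} := by
  have : {σ : JSite b d N → G × Bool | ∀ X ∈ M, markOf σ X = true} =
      ⋂ X ∈ M, {σ | markOf σ X = true} := by ext σ; simp
  rw [this]
  exact Finset.measurableSet_biInter M fun X _ =>
    measurableSet_eq_fun (measurable_markOf X) measurable_const

omit [Group G] in
/-- An event of the link field is an outside event for every set of mark sites. [folklore] -/
theorem measurableSet_cylinderEvents_preimage_uOf (M : Finset (FarPoly b d N))
    {B : Set (GaugeConfig d N G)} (hB : MeasurableSet B) :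
    MeasurableSet[cylinderEvents (X := fun _ : JSite b d N => G × Bool)
      ((↑(M.map (marksEmb b d N)) : Set (JSite b d N))ᶜ)] (uOf ⁻¹' B) := by
  have hu : Measurable[cylinderEvents (X := fun _ : JSite b d N => G × Bool)
      ((↑(M.map (marksEmb b d N)) : Set (JSite b d N))ᶜ)]
      (uOf (b := b) (d := d) (N := N) (G := G)) := by
    refine @measurable_pi_lambda _ _ (fun _ => G) (cylinderEvents _) _ _ fun e => ?_
    refine measurable_fst.comp (measurable_cylinderEvent_apply (i := Sum.inl e) ?_)
    simp
  exact hu hB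

omit [Group G] [MeasurableSpace G] in
/-- Gluing marks only does not change the link field. [folklore] -/
theorem uOf_glueWith_map_inr (M : Finset (FarPoly b d N))
    (u : ↥(M.map (marksEmb b d N)) → G × Bool) (ξ : JSite b d N → G × Bool) :
    uOf (glueWith (M.map (marksEmb b d N)) u ξ) = uOf ξ := by
  funext e
  simp only [uOf]
  rw [glueWith_apply_not_mem]
  simp

/-- The mark part of the joint energy as a sum over all sites (zero at link sites). [folklore] -/
def siteTerm (U : GaugeConfig d N G) : JSite b d N → G × Bool → ℝ :=
  Sum.elim (fun _ _ => 0) (fun X s => if s.2 then Real.log (W.hTilt X.1 U) else 0)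

section Joint

variable [TopologicalSpace G] [IsTopologicalGroup G] [CompactSpace G] [BorelSpace G]
  {Nρ : ℕ} (ρ : G →* Matrix (Fin Nρ) (Fin Nρ) ℂ)

/-- The site-dependent a priori measures of the joint system: `Haar ⊗ δ_false` at a link,
`δ_1 ⊗ Bernoulli(p_X)` at the far polymer `X`. [folklore] -/
def jointRef : JSite b d N → Measure (G × Bool) :=
  Sum.elim (fun _ => (haarProbability G).prod (Measure.dirac false))
    (fun X => (Measure.dirac (1 : G)).prod (bern (W.pAct X.1)))

/-- Every a priori measure of the joint system is a probability measure. [folklore] -/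
instance isProbabilityMeasure_jointRef (v : JSite b d N) : IsProbabilityMeasure (W.jointRef v) := by
  rcases v with e | X
  · simp only [jointRef, Sum.elim_inl]; infer_instance
  · simp only [jointRef, Sum.elim_inr]
    haveI := isProbabilityMeasure_bern (W.pAct_nonneg X.1) (W.pAct_le_one X.1)
    infer_instance

/-- The energy of the joint system: `-β S_W(U) - W_near(U) + ∑_X n_X log h_X(U)` (near = single
blocks). [folklore] -/
def jointEnergy (β : ℝ) (ξ : JSite b d N → G × Bool) : ℝ :=
  -β * wilsonAction ρ (uOf ξ) - (W.restrict fun X => X.card = 1).total (uOf ξ) +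
    ∑ X : FarPoly b d N, if markOf ξ X then Real.log (W.hTilt X.1 (uOf ξ)) else 0

omit [TopologicalSpace G] [IsTopologicalGroup G] [CompactSpace G] [BorelSpace G] in
/-- The joint energy: base energy of the link field plus the sum of the site terms. [folklore] -/
theorem jointEnergy_eq (β : ℝ) (ξ : JSite b d N → G × Bool) :
    W.jointEnergy ρ β ξ = (-β * wilsonAction ρ (uOf ξ) -
      (W.restrict fun X => X.card = 1).total (uOf ξ)) +
      ∑ v : JSite b d N, W.siteTerm (uOf ξ) v (ξ v) := by
  unfold jointEnergy siteTerm markOf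
  rw [Fintype.sum_sum_type]
  simp

/-- The DLR kernels of the joint system (glued site-dependent product reference tilted by the
joint energy). [folklore] -/
def jointSpec (β : ℝ) : Specification (JSite b d N) (G × Bool) := fun Λ ξ =>
  ((Measure.pi fun v : ↥Λ => W.jointRef v).map (glueWith Λ · ξ)).tilted (W.jointEnergy ρ β)

/-- The joint Gibbs measure (full-volume kernel): product reference tilted by the joint energy.
[folklore] -/
def jointMeasure (β : ℝ) : Measure (JSite b d N → G × Bool) :=
  (Measure.pi (W.jointRef (b := b))).tilted (W.jointEnergy ρ β)

variable (hρ : Continuous ρ) [SecondCountableTopology G]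
include hρ

omit [CompactSpace G] in
/-- The joint energy is measurable. [folklore] -/
theorem measurable_jointEnergy (β : ℝ) : Measurable (W.jointEnergy (b := b) ρ β) := by
  unfold jointEnergy
  refine ((((measurable_wilsonAction ρ hρ).comp measurable_uOf).const_mul _).sub
    ((measurable_total _).comp measurable_uOf)).add (Finset.measurable_sum _ fun X _ => ?_)
  refine Measurable.ite ?_ ((Real.measurable_log.comp (W.measurable_hTilt X.1)).comp measurable_uOf)
    measurable_const
  exact measurableSet_eq_fun (measurable_markOf X) measurable_const

omit [IsTopologicalGroup G] [BorelSpace G] [SecondCountableTopology G] in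
/-- The joint energy is bounded. [folklore] -/
theorem exists_abs_jointEnergy_le (β : ℝ) :
    ∃ C, ∀ ξ : JSite b d N → G × Bool, |W.jointEnergy ρ β ξ| ≤ C := by
  obtain ⟨C₁, hC₁⟩ := exists_abs_action_le ρ hρ β (W.restrict fun X => X.card = 1)
  refine ⟨C₁ + ∑ X : FarPoly b d N, (1 + 2 * W.supNorm X.1), fun ξ => ?_⟩
  unfold jointEnergy
  refine (abs_add_le _ _).trans (add_le_add (hC₁ _) ?_)
  refine (abs_sum_le_sum_abs _ _).trans (sum_le_sum fun X _ => ?_)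
  split_ifs
  · exact W.abs_log_hTilt_le X.1 _
  · rw [abs_zero]; linarith [W.supNorm_nonneg X.1]

/-- **The joint kernels form a specification** (finite site set, measurable singletons of `G`).
[folklore] -/
theorem isSpecification_jointSpec [MeasurableSingletonClass G] (β : ℝ) :
    IsSpecification (W.jointSpec (b := b) ρ β) :=
  isSpecification_tilted_map_glueWith_pi_hetero W.jointRef (fun v => NeZero.ne _)
    (φ := fun _ => W.jointEnergy ρ β) (fun _ => W.measurable_jointEnergy ρ hρ β)
    (fun _ => W.exists_abs_jointEnergy_le ρ hρ β) (fun _ _ _ _ _ _ => by simp only [sub_self])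

omit hρ in
/-- The full-volume joint kernel is the joint measure, for every boundary condition. [folklore] -/
theorem jointSpec_univ (β : ℝ) (ξ : JSite b d N → G × Bool) :
    W.jointSpec ρ β Finset.univ ξ = W.jointMeasure ρ β := by
  unfold jointSpec jointMeasure
  rw [map_glueWith_univ_pi_hetero]

/-- **The joint measure is a Gibbs measure for the joint kernels.** [folklore] -/
theorem isGibbsMeasure_jointMeasure [MeasurableSingletonClass G] (β : ℝ) :
    IsGibbsMeasure (W.jointSpec (b := b) ρ β) (W.jointMeasure ρ β) := by
  have h := (W.isSpecification_jointSpec ρ hρ (b := b) β).isGibbsMeasure_univ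
    (fun _ => ((1 : G), false))
  rwa [jointSpec_univ] at h

end Joint

end QuasiLocalGaugePerturbation

end Literature.MathematicalPhysics.QuantumFieldTheory

end
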